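import Literature.NumberTheory.NumberFields.ArtinKernelRayClassGroups
import HarnessLib

/-!
# The kernels of `𝔸^×_{f,K}/K^× → C_𝔪(K)` form a basis of the open neighbourhoods of `1` in `𝔸^×_{f,K}/K^×`
# (Milne, *Complex Multiplication*, proof of Thm. 9.10; [CFT] V 4.6)

Topic `NumberTheory/NumberFields`; namespace `Literature.NumberTheory.NumberFields`.  Lane `lit-hodgefound` (Track 2, Layer
A3 skeleton seat `skel-3`, row A3-G42 FILE 3, a rider of `…/ArtinKernelRayClassGroups`).  THEOREMS ONLY, all proved; no
definition, no named fact (D-0026, net debt 0).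

## The print, verbatim

J. S. Milne, *Complex Multiplication* (version July 14, 2020), Ch. II §9, proof of THEOREM 9.10 (p. 80 L8–L18; cached text
`paper:url-8ccc30e4daab` p0080):

> «… the kernels of the homomorphisms `𝔸^×_{f,E}/E^× → C_m(E)`, as `m` runs over the positive integers, form a basis for
> the open neighbourhoods of `1` in `𝔸^×_{f,E}/E^×` (cf. CFT, V, 4.6)».

Here `𝔸^×_{f,K}/K^×` is the quotient of the finite idèle group `(𝔸_{K,f})^×` by the principal finite idèles `K^×`
(`(FiniteAdeleRing.unitEmbedding (𝓞 K) K).range`) with the QUOTIENT TOPOLOGY, `C_𝔪(K) = (𝔸^×_{f,K}/K^×)/(image of W_𝔪)`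
for the congruence subgroup `W_𝔪 = IdeleAction.congruenceUnits 𝔪` (moduli without archimedean part, as for a CM field),
so the kernel of `𝔸^×_{f,K}/K^× → C_𝔪(K)` is the image `W̄_𝔪` of `W_𝔪` (= the image of `K^× · W_𝔪`).

* `map_mk_sup_congruenceUnits_eq` (the kernel: image of `K^× W_𝔪` = image of `W_𝔪`), `mk_mem_map_congruenceUnits_iff`
  (`x̄ ∈ W̄_𝔪 ↔ x ∈ K^× · W_𝔪`);
* `isOpen_map_mk_congruenceUnits` (each kernel is OPEN: the quotient map is open);
* **`exists_map_mk_congruenceUnits_subset`** (every neighbourhood of `1` contains some `W̄_𝔪`, `𝔪 ≠ 0`) and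
  **`exists_map_mk_congruenceUnits_span_subset`** (… some `W̄_{(m)}`, `m ∈ ℕ_{>0}` — «as m runs over the positive
  integers»): the kernels form a BASIS of the open neighbourhoods of `1`;
* `iInf_map_mk_congruenceUnits_eq` : `⋂_𝔪 W̄_𝔪 = Ē/K^×` (the image of the closure of `K^×`; with
  `…/ArtinKernelRayClassGroups` §1) — for `K` totally complex this is the kernel of the Artin map on `𝔸^×_{f,K}/K^×`.

## References

* J. S. Milne, *Complex Multiplication* (2006; version July 14, 2020), Ch. II §9, proof of Thm. 9.10 (p. 80). [MilneCM2006]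
* J. S. Milne, *Class Field Theory* (course notes), Ch. V Thm. 4.6 (cited by Milne as [CFT, V, 4.6]). [cited through MilneCM2006]
* J. Neukirch, *Algebraic Number Theory* (1999), Ch. VI §1 Prop. (1.8). [NeukirchANT1999]

## Provenance

Lane `lit-hodgefound`, seat `literature-prover-lit-hodgefound-skel-3-g27-0` (row A3-G42, FILE 3 — rider).
-/

set_option autoImplicit false

noncomputable section

open NumberField IsDedekindDomain Topology

namespace Literature.NumberTheory.NumberFields

variable (K : Type) [Field K] [NumberField K]

/-- `x̄ ∈ H̄ ↔ x ∈ H` for a subgroup `H ⊇ K^×` of the finite idèles and its image `H̄` in `𝔸^×_{f,K}/K^×`. [folklore] -/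
private theorem mk_mem_map_iff_of_le {H : Subgroup (FiniteAdeleRing (𝓞 K) K)ˣ}
    (hH : (FiniteAdeleRing.unitEmbedding (𝓞 K) K).range ≤ H) (x : (FiniteAdeleRing (𝓞 K) K)ˣ) :
    QuotientGroup.mk' (FiniteAdeleRing.unitEmbedding (𝓞 K) K).range x ∈
        H.map (QuotientGroup.mk' (FiniteAdeleRing.unitEmbedding (𝓞 K) K).range) ↔ x ∈ H := by
  constructor
  · rintro ⟨h, hh, hhx⟩
    have hmem : h⁻¹ * x ∈ (FiniteAdeleRing.unitEmbedding (𝓞 K) K).range := QuotientGroup.eq.mp hhx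
    have : x = h * (h⁻¹ * x) := by rw [mul_inv_cancel_left]
    rw [this]
    exact H.mul_mem hh (hH hmem)
  · exact fun hx => ⟨x, hx, rfl⟩

/-- **The kernel of `𝔸^×_{f,K}/K^× → C_𝔪(K)`**: the image of `K^× · W_𝔪` in `𝔸^×_{f,K}/K^×` equals the image `W̄_𝔪` of
the congruence subgroup `W_𝔪` alone. [cite: MilneCM2006, Ch. II §9, proof of Thm. 9.10 (p. 80)] -/
theorem map_mk_sup_congruenceUnits_eq (𝔪 : Ideal (𝓞 K)) :
    ((FiniteAdeleRing.unitEmbedding (𝓞 K) K).range ⊔ IdeleAction.congruenceUnits (K := K) 𝔪).map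
        (QuotientGroup.mk' (FiniteAdeleRing.unitEmbedding (𝓞 K) K).range) =
      (IdeleAction.congruenceUnits (K := K) 𝔪).map
        (QuotientGroup.mk' (FiniteAdeleRing.unitEmbedding (𝓞 K) K).range) := by
  rw [Subgroup.map_sup, (Subgroup.map_eq_bot_iff _).mpr (le_of_eq (QuotientGroup.ker_mk' _).symm), bot_sup_eq]

/-- `x̄ ∈ W̄_𝔪 ↔ x ∈ K^× · W_𝔪`: the class of a finite idèle lies in the kernel of `𝔸^×_{f,K}/K^× → C_𝔪(K)` iff the
idèle lies in `K^× · W_𝔪`. [cite: MilneCM2006, Ch. II §9, proof of Thm. 9.10 (p. 80)] [cite: NeukirchANT1999, Ch. VI §1 Def. (1.7)] -/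
theorem mk_mem_map_congruenceUnits_iff (𝔪 : Ideal (𝓞 K)) (x : (FiniteAdeleRing (𝓞 K) K)ˣ) :
    QuotientGroup.mk' (FiniteAdeleRing.unitEmbedding (𝓞 K) K).range x ∈
        (IdeleAction.congruenceUnits (K := K) 𝔪).map
          (QuotientGroup.mk' (FiniteAdeleRing.unitEmbedding (𝓞 K) K).range) ↔
      x ∈ (FiniteAdeleRing.unitEmbedding (𝓞 K) K).range ⊔ IdeleAction.congruenceUnits (K := K) 𝔪 := by
  rw [← map_mk_sup_congruenceUnits_eq]
  exact mk_mem_map_iff_of_le K le_sup_left x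

/-- **Each kernel `W̄_𝔪` is OPEN in `𝔸^×_{f,K}/K^×`** (quotient topology; the quotient map is open and `W_𝔪` is open).
[cite: MilneCM2006, Ch. II §9, proof of Thm. 9.10 (p. 80) («open neighbourhoods of 1»)] [cite: NeukirchANT1999, Ch. VI §1 Prop. (1.8)] -/
theorem isOpen_map_mk_congruenceUnits (𝔪 : Ideal (𝓞 K)) :
    IsOpen ((IdeleAction.congruenceUnits (K := K) 𝔪).map
      (QuotientGroup.mk' (FiniteAdeleRing.unitEmbedding (𝓞 K) K).range) :
        Set ((FiniteAdeleRing (𝓞 K) K)ˣ ⧸ (FiniteAdeleRing.unitEmbedding (𝓞 K) K).range)) := by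
  rw [Subgroup.coe_map]
  exact QuotientGroup.isOpenMap_coe _ (IdeleAction.isOpen_congruenceUnits (K := K) 𝔪)

/-- **The kernels `W̄_𝔪`, `𝔪 ≠ 0`, form a BASIS of the open neighbourhoods of `1` in `𝔸^×_{f,K}/K^×`**: every
neighbourhood of `1` contains one of them (the `W_𝔪` are a basis of neighbourhoods of `1` in `(𝔸_{K,f})^×`, Neukirch VI
(1.8), and the quotient map is continuous). [cite: MilneCM2006, Ch. II §9, proof of Thm. 9.10 (p. 80) («form a basis for the open neighbourhoods of 1 … (cf. CFT, V, 4.6)»)]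
[cite: NeukirchANT1999, Ch. VI §1 Prop. (1.8)] -/
theorem exists_map_mk_congruenceUnits_subset
    {U : Set ((FiniteAdeleRing (𝓞 K) K)ˣ ⧸ (FiniteAdeleRing.unitEmbedding (𝓞 K) K).range)} (hU : U ∈ 𝓝 1) :
    ∃ 𝔪 : Ideal (𝓞 K), 𝔪 ≠ ⊥ ∧
      ((IdeleAction.congruenceUnits (K := K) 𝔪).map
          (QuotientGroup.mk' (FiniteAdeleRing.unitEmbedding (𝓞 K) K).range) : Set _) ⊆ U := by
  have hU' : (QuotientGroup.mk' (FiniteAdeleRing.unitEmbedding (𝓞 K) K).range) ⁻¹' U ∈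
      𝓝 (1 : (FiniteAdeleRing (𝓞 K) K)ˣ) :=
    QuotientGroup.continuous_mk.continuousAt.preimage_mem_nhds
      (by rwa [QuotientGroup.mk_one])
  obtain ⟨𝔪, h𝔪, hW⟩ := IdeleAction.exists_congruenceUnits_subset_of_mem_nhds hU'
  refine ⟨𝔪, h𝔪, ?_⟩
  rw [Subgroup.coe_map, Set.image_subset_iff]
  exact hW

/-- The same «as `m` runs over the positive integers»: every neighbourhood of `1` in `𝔸^×_{f,K}/K^×` contains the
kernel `W̄_{(m)}` of `𝔸^×_{f,K}/K^× → C_m(K)` for some integer `m > 0`.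
[cite: MilneCM2006, Ch. II §9, proof of Thm. 9.10 (p. 80) («as m runs over the positive integers»)] -/
theorem exists_map_mk_congruenceUnits_span_subset
    {U : Set ((FiniteAdeleRing (𝓞 K) K)ˣ ⧸ (FiniteAdeleRing.unitEmbedding (𝓞 K) K).range)} (hU : U ∈ 𝓝 1) :
    ∃ m : ℕ, m ≠ 0 ∧
      ((IdeleAction.congruenceUnits (K := K) (Ideal.span {(m : 𝓞 K)})).map
          (QuotientGroup.mk' (FiniteAdeleRing.unitEmbedding (𝓞 K) K).range) : Set _) ⊆ U := by
  obtain ⟨𝔪, h𝔪, hW⟩ := exists_map_mk_congruenceUnits_subset K hU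
  refine ⟨Ideal.absNorm 𝔪, Ideal.absNorm_eq_zero_iff.not.mpr h𝔪, subset_trans ?_ hW⟩
  exact Subgroup.map_mono (congruenceUnits_span_absNorm_le K h𝔪)

/-- The kernels are open neighbourhoods of `1`: `W̄_𝔪 ∈ 𝓝 1`. [cite: MilneCM2006, Ch. II §9, proof of Thm. 9.10 (p. 80)] -/
theorem map_mk_congruenceUnits_mem_nhds (𝔪 : Ideal (𝓞 K)) :
    ((IdeleAction.congruenceUnits (K := K) 𝔪).map
        (QuotientGroup.mk' (FiniteAdeleRing.unitEmbedding (𝓞 K) K).range) : Set _) ∈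
      𝓝 (1 : (FiniteAdeleRing (𝓞 K) K)ˣ ⧸ (FiniteAdeleRing.unitEmbedding (𝓞 K) K).range) :=
  (isOpen_map_mk_congruenceUnits K 𝔪).mem_nhds (one_mem _)

/-- **`⋂_{𝔪 ≠ 0} W̄_𝔪 = Ē/K^×`**: the intersection of the kernels of `𝔸^×_{f,K}/K^× → C_𝔪(K)` is the image of the closure
`Ē` of `K^×` (`…/ArtinKernelRayClassGroups` §1) — for `K` totally complex, the kernel of the Artin map on
`𝔸^×_{f,K}/K^×` («this common kernel is equal to the kernel of the Artin map»).
[cite: MilneCM2006, Ch. II §9, proof of Thm. 9.10 (p. 80)] [cite: Milne2007FundamentalCM, §3.4, proof of Thm. 3.10 (last paragraph)] -/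
theorem mk_mem_forall_map_congruenceUnits_iff (x : (FiniteAdeleRing (𝓞 K) K)ˣ) :
    (∀ 𝔪 : Ideal (𝓞 K), 𝔪 ≠ ⊥ →
        QuotientGroup.mk' (FiniteAdeleRing.unitEmbedding (𝓞 K) K).range x ∈
          (IdeleAction.congruenceUnits (K := K) 𝔪).map
            (QuotientGroup.mk' (FiniteAdeleRing.unitEmbedding (𝓞 K) K).range)) ↔
      QuotientGroup.mk' (FiniteAdeleRing.unitEmbedding (𝓞 K) K).range x ∈
        (FiniteAdeleRing.unitEmbedding (𝓞 K) K).range.topologicalClosure.map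
          (QuotientGroup.mk' (FiniteAdeleRing.unitEmbedding (𝓞 K) K).range) := by
  rw [mk_mem_map_iff_of_le K (Subgroup.le_topologicalClosure _),
    mem_topologicalClosure_range_iff_forall_mem_sup_congruenceUnits]
  exact forall₂_congr fun 𝔪 _ => mk_mem_map_congruenceUnits_iff K 𝔪 x

end Literature.NumberTheory.NumberFields

end
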